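import Summits.Ventures.HodgeRepro2.T5SU11XiTransform

/-!
# The Jacobi transform of the coefficient modulus through Legendre's duplication formula:
`m̂_k(λ) = π Γ((k−λ)/2) Γ((k+λ)/2 − 1) / Γ(k/2)²`

The closed form of `T5SU11JacobiTransform`,
`m̂_k(λ) = 2^{k−2} √π Γ((k−1)/2)/Γ(k/2) · Γ((k−λ)/2) Γ((k+λ)/2 − 1)/Γ(k−1)`, carries the Abel constant
`C_k = √π Γ((k−1)/2)/Γ(k/2)` and the factor `Γ(k − 1)` of the Iwasawa evaluation separately. Legendre's
duplication formula `Γ(s) Γ(s + 1/2) = Γ(2s) 2^{1−2s} √π` (`Real.Gamma_mul_Gamma_add_half`) at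
`s = (k−1)/2` reads `Γ(k − 1) = 2^{k−2} Γ((k−1)/2) Γ(k/2)/√π` (`Gamma_sub_one_eq_dup`), and the two
collapse to the symmetric **`m̂_k(λ) = π Γ((k−λ)/2) Γ((k+λ)/2 − 1)/Γ(k/2)²`** for `k > 1`, `λ < k`,
`k + λ > 2` (`integral_orbit_rpow_mul_sph_dup`): the `W`-symmetry `λ ↦ 2 − λ` exchanges the two Gamma
factors (`integral_orbit_rpow_mul_sph_dup_two_sub`), the normalised transform is
**`m̂_k(λ)/m̂_k(1) = Γ((k−λ)/2) Γ((k+λ)/2 − 1)/Γ((k−1)/2)²`** (`jacobi_div_xi_transform`, `≥ 1` on the strip by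
`T5SU11XiTransform.xi_transform_le_jacobi`: `Gamma_mul_Gamma_ge_sq`), and the special values `λ = 1`
(`π Γ((k−1)/2)²/Γ(k/2)²`, re-derived) and `λ = 0` (`2π/(k − 2)` for `k > 2`, re-derived through
`Γ(k/2) = (k/2 − 1) Γ(k/2 − 1)`) cross-check the two closed forms against each other. Nothing is claimed
about (N).

Blind lane: Mathlib + the HodgeRepro2 prefix only; no sorry; axioms ⊆ {propext, Classical.choice,
Quot.sound}.
-/

namespace Summit.Ventures.HodgeRepro2.T5SU11JacobiDuplication

open MeasureTheory MeasureTheory.Measure Metric Set Filter Topology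
open T5SU11Unimodular T5SU11Fibration T5SU11Cartan T5HaarCircle T5BergmanCoefficient
  T5SU11FibrationHaar T5SU11SphericalFunction T5SU11SphericalSymmetry T5SU11JacobiIwasawa
  T5SU11JacobiTransform T5SU11XiTransform
open scoped Real

/-! ### Legendre's duplication formula at `s = (k − 1)/2` -/

/-- **`Γ(k − 1) = 2^{k−2} Γ((k−1)/2) Γ(k/2)/√π`** for `k > 1` (Legendre's duplication formula
`Γ(s) Γ(s + 1/2) = Γ(2s) 2^{1−2s} √π` at `s = (k − 1)/2`). -/
theorem Gamma_sub_one_eq_dup {k : ℝ} (hk : 1 < k) :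
    Real.Gamma (k - 1) = 2 ^ (k - 2) * Real.Gamma ((k - 1) / 2) * Real.Gamma (k / 2) / √π := by
  have h := Real.Gamma_mul_Gamma_add_half ((k - 1) / 2)
  rw [show (k - 1) / 2 + 1 / 2 = k / 2 by ring, show 2 * ((k - 1) / 2) = k - 1 by ring,
    show (1 : ℝ) - (k - 1) = -(k - 2) by ring, Real.rpow_neg (by norm_num : (0 : ℝ) ≤ 2)] at h
  have h2 : (0 : ℝ) < 2 ^ (k - 2) := Real.rpow_pos_of_pos (by norm_num) _
  have hs : 0 < √π := Real.sqrt_pos.mpr Real.pi_pos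
  have hg : 0 < Real.Gamma (k - 1) := Real.Gamma_pos_of_pos (by linarith)
  rw [mul_assoc, h]
  field_simp

/-- The same, solved for the Abel constant: `√π Γ((k−1)/2)/Γ(k/2) = 2^{2−k} · Γ(k − 1) · π/Γ(k/2)²`. -/
theorem abel_const_eq_dup {k : ℝ} (hk : 1 < k) :
    √π * Real.Gamma ((k - 1) / 2) / Real.Gamma (k / 2)
      = 2 ^ (2 - k) * Real.Gamma (k - 1) * π / Real.Gamma (k / 2) ^ 2 := by
  rw [Gamma_sub_one_eq_dup hk, show (2 : ℝ) - k = -(k - 2) by ring,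
    Real.rpow_neg (by norm_num : (0 : ℝ) ≤ 2)]
  have h2 : (0 : ℝ) < 2 ^ (k - 2) := Real.rpow_pos_of_pos (by norm_num) _
  have hs : 0 < √π := Real.sqrt_pos.mpr Real.pi_pos
  have hsq : √π * √π = π := Real.mul_self_sqrt Real.pi_pos.le
  have g2 : 0 < Real.Gamma (k / 2) := Real.Gamma_pos_of_pos (by linarith)
  set s := √π with hs_def
  clear_value s
  rw [← hsq]
  field_simp

/-! ### The symmetric closed form -/

section measure

variable [MeasurableSpace Circle] [BorelSpace Circle]

/-- **THE JACOBI TRANSFORM OF THE COEFFICIENT MODULUS IN SYMMETRIC CLOSED FORM**: for `k > 1`, `λ < k`,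
`k + λ > 2`, `∫_G (1 − |g·0|²)^{k/2} φ_λ(g) dν = π Γ((k−λ)/2) Γ((k+λ)/2 − 1)/Γ(k/2)²`. -/
theorem integral_orbit_rpow_mul_sph_dup {k lam : ℝ} (hk : 1 < k) (h1 : lam < k) (h2 : 2 < k + lam) :
    ∫ g, (1 - ‖orbit g‖ ^ 2) ^ (k / 2) * sph lam g ∂(nu haarCircle)
      = π * Real.Gamma ((k - lam) / 2) * Real.Gamma ((k + lam) / 2 - 1) / Real.Gamma (k / 2) ^ 2 := by
  rw [integral_orbit_rpow_mul_sph hk h1 h2, Gamma_sub_one_eq_dup hk]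
  have g1 : 0 < Real.Gamma ((k - 1) / 2) := Real.Gamma_pos_of_pos (by linarith)
  have g2 : 0 < Real.Gamma (k / 2) := Real.Gamma_pos_of_pos (by linarith)
  have h2' : (0 : ℝ) < 2 ^ (k - 2) := Real.rpow_pos_of_pos (by norm_num) _
  have hs : 0 < √π := Real.sqrt_pos.mpr Real.pi_pos
  have hsq : √π * √π = π := Real.mul_self_sqrt Real.pi_pos.le
  set s := √π with hs_def
  clear_value s
  rw [← hsq]
  field_simp

/-- The `W`-symmetry in the symmetric form: the two Gamma factors are exchanged by `λ ↦ 2 − λ`. -/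
theorem integral_orbit_rpow_mul_sph_dup_two_sub {k lam : ℝ} (hk : 1 < k) (h1 : lam < k)
    (h2 : 2 < k + lam) :
    ∫ g, (1 - ‖orbit g‖ ^ 2) ^ (k / 2) * sph (2 - lam) g ∂(nu haarCircle)
      = π * Real.Gamma ((k + lam) / 2 - 1) * Real.Gamma ((k - lam) / 2) / Real.Gamma (k / 2) ^ 2 := by
  rw [integral_orbit_rpow_mul_sph_dup hk (by linarith) (by linarith),
    show (k - (2 - lam)) / 2 = (k + lam) / 2 - 1 by ring,
    show (k + (2 - lam)) / 2 - 1 = (k - lam) / 2 by ring]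

/-- **`λ = 1`** re-derived from the symmetric form: `∫_G m_k Ξ dν = π Γ((k−1)/2)²/Γ(k/2)²`
(= `T5SU11XiTransform.integral_orbit_rpow_mul_sph_one_eq`). -/
theorem integral_orbit_rpow_mul_sph_dup_one {k : ℝ} (hk : 1 < k) :
    ∫ g, (1 - ‖orbit g‖ ^ 2) ^ (k / 2) * sph 1 g ∂(nu haarCircle)
      = π * Real.Gamma ((k - 1) / 2) ^ 2 / Real.Gamma (k / 2) ^ 2 := by
  rw [integral_orbit_rpow_mul_sph_dup hk (by linarith) (by linarith),
    show (k + 1) / 2 - 1 = (k - 1) / 2 by ring]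
  ring

/-- The two derivations of the critical value agree (a cross-check of the duplication step against
the Fourier–Laplace evaluation of `T5SU11XiTransform`). -/
theorem integral_orbit_rpow_mul_sph_dup_one_eq {k : ℝ} (hk : 1 < k) :
    π * Real.Gamma ((k - 1) / 2) ^ 2 / Real.Gamma (k / 2) ^ 2
      = (√π * Real.Gamma ((k - 1) / 2) / Real.Gamma (k / 2)) ^ 2 := by
  rw [← integral_orbit_rpow_mul_sph_dup_one hk, integral_orbit_rpow_mul_sph_one_eq_sq hk]

/-- **`λ = 0`** re-derived from the symmetric form: `∫_G m_k dν = 2π/(k − 2)` for `k > 2`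
(`Γ(k/2) = (k/2 − 1) Γ(k/2 − 1)`; = `T5SU11JacobiTransform.integral_orbit_rpow_mul_sph_zero`). -/
theorem integral_orbit_rpow_mul_sph_dup_zero {k : ℝ} (hk : 2 < k) :
    ∫ g, (1 - ‖orbit g‖ ^ 2) ^ (k / 2) * sph 0 g ∂(nu haarCircle) = 2 * π / (k - 2) := by
  rw [integral_orbit_rpow_mul_sph_dup (by linarith) (by linarith) (by linarith), sub_zero, add_zero]
  have hne : k / 2 - 1 ≠ 0 := by
    intro h
    linarith
  have hG : Real.Gamma (k / 2) = (k / 2 - 1) * Real.Gamma (k / 2 - 1) := by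
    rw [← Real.Gamma_add_one hne, sub_add_cancel]
  have g3 : 0 < Real.Gamma (k / 2 - 1) := Real.Gamma_pos_of_pos (by linarith)
  have hk2 : k - 2 ≠ 0 := by
    intro h
    linarith
  rw [hG]
  set G := Real.Gamma (k / 2 - 1) with hGdef
  clear_value G
  have g3' : G ≠ 0 := g3.ne'
  field_simp

/-- **The normalised transform**: `m̂_k(λ)/m̂_k(1) = Γ((k−λ)/2) Γ((k+λ)/2 − 1)/Γ((k−1)/2)²`. -/
theorem jacobi_div_xi_transform {k lam : ℝ} (hk : 1 < k) (h1 : lam < k) (h2 : 2 < k + lam) :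
    (∫ g, (1 - ‖orbit g‖ ^ 2) ^ (k / 2) * sph lam g ∂(nu haarCircle))
        / ∫ g, (1 - ‖orbit g‖ ^ 2) ^ (k / 2) * sph 1 g ∂(nu haarCircle)
      = Real.Gamma ((k - lam) / 2) * Real.Gamma ((k + lam) / 2 - 1) / Real.Gamma ((k - 1) / 2) ^ 2 := by
  rw [integral_orbit_rpow_mul_sph_dup hk h1 h2, integral_orbit_rpow_mul_sph_dup_one hk]
  have g1 : 0 < Real.Gamma ((k - 1) / 2) := Real.Gamma_pos_of_pos (by linarith)
  have g2 : 0 < Real.Gamma (k / 2) := Real.Gamma_pos_of_pos (by linarith)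
  field_simp

/-- **`Γ((k−λ)/2) Γ((k+λ)/2 − 1) ≥ Γ((k−1)/2)²`** on the strip `λ < k`, `k + λ > 2` (`k > 1`): the
minimality `Ξ ≤ φ_λ` of `T5SU11XiTransform.xi_transform_le_jacobi` read through the symmetric closed form —
an inequality between Gamma values (log-convexity of `Γ` at the midpoint `(k−1)/2` of `(k−λ)/2` and
`(k+λ)/2 − 1`), obtained here from the spherical functions. -/
theorem Gamma_mul_Gamma_ge_sq {k lam : ℝ} (hk : 1 < k) (h1 : lam < k) (h2 : 2 < k + lam) :
    Real.Gamma ((k - 1) / 2) ^ 2 ≤ Real.Gamma ((k - lam) / 2) * Real.Gamma ((k + lam) / 2 - 1) := by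
  have h := xi_transform_le_jacobi hk h1 h2
  rw [integral_orbit_rpow_mul_sph_dup hk h1 h2, integral_orbit_rpow_mul_sph_dup_one hk] at h
  have g2 : 0 < Real.Gamma (k / 2) ^ 2 := pow_pos (Real.Gamma_pos_of_pos (by linarith)) 2
  rw [div_le_div_iff_of_pos_right g2] at h
  have hπ : 0 < π := Real.pi_pos
  nlinarith [h]

end measure

end Summit.Ventures.HodgeRepro2.T5SU11JacobiDuplication
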